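import Summits.ABC.StewartYu.PadicG3ParOdd2
import Summits.ABC.StewartYu.PadicG3ParNB
import HarnessLib

/-!
# The `𝔑`-threaded odd-`p` record: the CONSTRUCTOR `parOddN` (twin of `parOdd₂` with the saturation index `N`)

Support file (one definition and its field lemmas; no named facts). Cell `abc-stewartyu`, route `YuMatveevShapeRat`,
crux r3 `PadicCoreOddRat` (stmt-ABC-20503); seat p1 (record owner), asked by the line lead p2 (STATUS 2026-08-27T19:09:08Z (1),
19:25:51Z: «`stub_recordSat` = intro; `P := parOddN …`; …»). The record of the saturated odd-`p` frame at a datum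
`(p ≥ 3, n ≥ 1, V, Vmax, W̃ ≥ 1, N ≥ 1)` is the R21 record `parOdd₂ p … V Vmax W̃` (`N_q := K = p^m·(p−1)`, `K₀ = p − 1`, `θ₀ = ½`,
`Amax = min Vmax (2ⁿ∏V)`, `m = ⌈8(n+1)/log p − ½⌉` — ONE family for every `m`, plan R28) extended by the index `N = [𝔑 : ℤⁿ]` with
its two frame-side facts `N ≤ (2/log 2)ⁿ·∏V` and `log N ≤ W̃` (the budget letter `W̃` of plan R40).
* `parOddN` and the `rfl`/field lemmas `p_eq`, `A_eq`, `W_eq`, `N_eq`, `K₀_eq`, `θ₀_eq`, `toPadicG3Par_eq`, `Ω_eq`, `K_eq`;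
* the side conditions every record theorem asks for: `Nq_eq_K`, `two_le_K`, `K₀_real` (`(K₀:ℝ) = p − 1`), `K₀_ge`, `three_le_p`,
  `half_le_θ₀`, `A_one_le`, `Amax_le_Vmax`, `Amax_le_prod`, `Amax_le_two_pow_Ω`, `pow_g_le_K'` (`gⁿ ≤ K`).

## References
* [Nesterenko2003] Yu. V. Nesterenko, LNM 1819 (2003) — §3.4 Prop 3.7, §3.5 (3.24).
* [Yu2013] K. Yu, Acta Math. 211 (2013) — §7 (the class count `p^m(p−1)`).
-/

noncomputable section

open Finset

namespace Summit.ABC.StewartYu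

/-- **The record of the saturated odd-`p` frame**: `parOdd₂` extended by the saturation index `N`. [folklore] -/
def parOddN (p : ℕ) (hp : 3 ≤ p) {n : ℕ} (hn : 1 ≤ n) (V : Fin n → ℝ) (Vmax W : ℝ) (hV1 : ∀ j, 1 ≤ V j)
    (hVm : ∀ j, V j ≤ Vmax) (hW : 1 ≤ W) (N : ℕ) (hN : 1 ≤ N)
    (hNΩ : (N : ℝ) ≤ (2 / Real.log 2) ^ n * ∏ j, V j) (hNW : Real.log N ≤ W) : PadicG3ParN n where
  toPadicG3Par := parOdd₂ p hp hn V Vmax W hV1 hVm hW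
  N := N
  hN := hN
  hNΩ := hNΩ
  hNW := hNW

namespace parOddN

variable (p : ℕ) (hp : 3 ≤ p) {n : ℕ} (hn : 1 ≤ n) (V : Fin n → ℝ) (Vmax W : ℝ) (hV1 : ∀ j, 1 ≤ V j)
  (hVm : ∀ j, V j ≤ Vmax) (hW : 1 ≤ W) (N : ℕ) (hN : 1 ≤ N)
  (hNΩ : (N : ℝ) ≤ (2 / Real.log 2) ^ n * ∏ j, V j) (hNW : Real.log N ≤ W)

/-- the parent record is `parOdd₂`. [folklore] -/
theorem toPadicG3Par_eq :
    (parOddN p hp hn V Vmax W hV1 hVm hW N hN hNΩ hNW).toPadicG3Par = parOdd₂ p hp hn V Vmax W hV1 hVm hW := rfl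
/-- field `p`. [folklore] -/
theorem p_eq : (parOddN p hp hn V Vmax W hV1 hVm hW N hN hNΩ hNW).p = p := rfl
/-- field `A`. [folklore] -/
theorem A_eq : (parOddN p hp hn V Vmax W hV1 hVm hW N hN hNΩ hNW).A = V := rfl
/-- field `W`. [folklore] -/
theorem W_eq : (parOddN p hp hn V Vmax W hV1 hVm hW N hN hNΩ hNW).W = W := rfl
/-- field `N`. [folklore] -/
theorem N_eq : (parOddN p hp hn V Vmax W hV1 hVm hW N hN hNΩ hNW).N = N := rfl
/-- field `K₀ = p − 1`. [folklore] -/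
theorem K₀_eq : (parOddN p hp hn V Vmax W hV1 hVm hW N hN hNΩ hNW).K₀ = p - 1 := rfl
/-- field `θ₀ = ½`. [folklore] -/
theorem θ₀_eq : (parOddN p hp hn V Vmax W hV1 hVm hW N hN hNΩ hNW).θ₀ = 1 / 2 := rfl
/-- `Ω = ∏ V`. [folklore] -/
theorem Ω_eq : (parOddN p hp hn V Vmax W hV1 hVm hW N hN hNΩ hNW).Ω = ∏ j, V j := rfl
/-- `K = p^m·(p − 1)`. [folklore] -/
theorem K_eq : (parOddN p hp hn V Vmax W hV1 hVm hW N hN hNΩ hNW).K =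
    p ^ (parOddN p hp hn V Vmax W hV1 hVm hW N hN hNΩ hNW).m * (p - 1) := rfl
/-- **`N_q = K`** (R21-b). [folklore] -/
theorem Nq_eq_K : (parOddN p hp hn V Vmax W hV1 hVm hW N hN hNΩ hNW).Nq =
    (parOddN p hp hn V Vmax W hV1 hVm hW N hN hNΩ hNW).K :=
  parOdd₂.Nq_eq_K p hp hn V Vmax W hV1 hVm hW
/-- `2 ≤ K`. [folklore] -/
theorem two_le_K : 2 ≤ (parOddN p hp hn V Vmax W hV1 hVm hW N hN hNΩ hNW).K := by
  rw [← Nq_eq_K]; exact parOdd₂.two_le_Nq p hp hn V Vmax W hV1 hVm hW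
/-- `3 ≤ p` (field form). [folklore] -/
theorem three_le_p : 3 ≤ (parOddN p hp hn V Vmax W hV1 hVm hW N hN hNΩ hNW).p := hp
/-- `(K₀ : ℝ) = p − 1`. [folklore] -/
theorem K₀_real : ((parOddN p hp hn V Vmax W hV1 hVm hW N hN hNΩ hNW).K₀ : ℝ) =
    (parOddN p hp hn V Vmax W hV1 hVm hW N hN hNΩ hNW).p - 1 := by
  rw [K₀_eq, p_eq, Nat.cast_sub (by omega)]; norm_num
/-- `p − 1 ≤ K₀` (real; the form `recordOddN_end` asks for). [folklore] -/
theorem K₀_ge : ((parOddN p hp hn V Vmax W hV1 hVm hW N hN hNΩ hNW).p : ℝ) - 1 ≤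
    (parOddN p hp hn V Vmax W hV1 hVm hW N hN hNΩ hNW).K₀ := (K₀_real p hp hn V Vmax W hV1 hVm hW N hN hNΩ hNW).ge
/-- `½ ≤ θ₀`. [folklore] -/
theorem half_le_θ₀ : (1 / 2 : ℝ) ≤ (parOddN p hp hn V Vmax W hV1 hVm hW N hN hNΩ hNW).θ₀ := le_of_eq (θ₀_eq ..).symm
/-- `1 ≤ Aⱼ`. [folklore] -/
theorem A_one_le : ∀ j, 1 ≤ (parOddN p hp hn V Vmax W hV1 hVm hW N hN hNΩ hNW).A j := hV1
/-- `Amax ≤ Vmax`. [folklore] -/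
theorem Amax_le_Vmax : (parOddN p hp hn V Vmax W hV1 hVm hW N hN hNΩ hNW).Amax ≤ Vmax :=
  parOdd₂.Amax_le_Vmax p hp hn V Vmax W hV1 hVm hW
/-- `Amax ≤ 2ⁿ·∏V`. [folklore] -/
theorem Amax_le_prod : (parOddN p hp hn V Vmax W hV1 hVm hW N hN hNΩ hNW).Amax ≤ 2 ^ n * ∏ j, V j :=
  parOdd₂.Amax_le_prod p hp hn V Vmax W hV1 hVm hW
/-- `Amax ≤ 2ⁿ·Ω`. [folklore] -/
theorem Amax_le_two_pow_Ω : (parOddN p hp hn V Vmax W hV1 hVm hW N hN hNΩ hNW).Amax ≤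
    2 ^ n * (parOddN p hp hn V Vmax W hV1 hVm hW N hN hNΩ hNW).Ω :=
  Amax_le_prod p hp hn V Vmax W hV1 hVm hW N hN hNΩ hNW
/-- `gⁿ ≤ K` (every `m`). [folklore] -/
theorem pow_g_le_K' : (parOddN p hp hn V Vmax W hV1 hVm hW N hN hNΩ hNW).g ^ n ≤
    ((parOddN p hp hn V Vmax W hV1 hVm hW N hN hNΩ hNW).K : ℝ) :=
  (parOddN p hp hn V Vmax W hV1 hVm hW N hN hNΩ hNW).pow_g_le_K (three_le_p ..) (K₀_ge ..)

end parOddN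

end Summit.ABC.StewartYu
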